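import Literature.NumberTheory.GaloisRepresentations.WeilGroupFrobeniusPowers
import Literature.NumberTheory.GaloisRepresentations.LocalGaloisGroupFrobeniusProofs
import Literature.RepresentationTheory.Semisimple.Twist
import Mathlib.LinearAlgebra.Eigenspace.Triangularizable
import Mathlib.Analysis.Complex.Polynomial.Basic
import Mathlib.Topology.Algebra.OpenSubgroup
import HarnessLib

/-!
# Irreducible representations of the Weil group are of Galois type up to an unramified twist

Topic `NumberTheory/GaloisRepresentations`; namespace
`Literature.NumberTheory.GaloisRepresentations.WeilGroup`.  Let `F` be a non-archimedean local
field, `W_F = WeilGroup F` (Weil topology; `deg : W_F → ℤ` with `deg = -1` on geometric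
Frobenii) and `ρ` a continuous (`WeilGroup.IsContinuousRep`: trivial on an open subgroup of `I_F`)
finite-dimensional complex representation of `W_F` which is *irreducible* (no invariant subspace
other than `⊥`, `⊤`).  Deligne, *Les constantes des équations fonctionnelles des fonctions `L`*
(Antwerp II, 1973), §4.10 and Prop. 3.1.2(iii) / Tate, *Number theoretic background* (Corvallis
1979), (2.2.1)–(2.2.3) / Rohrlich, *Root numbers* (PCMI 2009), Lecture 4 Prop. 4.1: **`ρ ≅ ρ₀ ⊗ ω`
with `ω` an unramified character and `ρ₀` of Galois type** (factoring through a finite quotient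
`Gal(L/F)`).  In the form needed for the uniqueness of local constants (Deligne 1973, Thm. 4.1) and
proved here (`exists_twist_ker_isOpen_finiteIndex`):

  there is an unramified character `χ : W_F →* ℂˣ` (`χ = 1` on `I_F`; in fact `χ w = z ^ deg w`)
  such that the kernel of the twist `ρ ⊗ χ` (`Representation.twist` of
  `Literature/RepresentationTheory/Semisimple/Twist`) is an **open subgroup of finite index** of
  `W_F`.

Proof (loc. cit.): `ρ` is trivial on an open `U ≤ I_F`, so some `ρ(Φ ^ k)` (`Φ` a geometric
Frobenius, `k ≥ 1`) commutes with `ρ(I_F)` (`exists_pow_commute_of_isOpen_ker`), hence with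
`ρ(W_F) = ⟨ρ(I_F), ρ(Φ)⟩` (`intertwines_of_inertia_of_frob`); by Schur's lemma
(`apply_eq_smul_of_forall_comp_eq`, from an eigenvalue, `Module.End.exists_eigenvalue`, whose
eigenspace is invariant) `ρ(Φ ^ k) = c` is a scalar, `c ≠ 0`; with `z ^ k = c` and
`χ w = z ^ deg w` the twist `ρ ⊗ χ` kills `U` and `Φ ^ k`, so its kernel `K` is open and
`W_F / K` is covered by the finitely many `Φ ^ j · (I_F / (K ∩ I_F))`, `0 ≤ j < k`, with
`I_F / (K ∩ I_F)` finite (`K ∩ I_F` is open in the compact `I_F`).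

Also proved, as the unramified character used: `zpowDegChar z : W_F →* ℂˣ`, `w ↦ z ^ deg w`
(`zpowersHom` composed with `WeilGroup.degHom`) — an `abbrev`-free inline term; its values are
recorded by `zpowDegChar_apply`, `zpowDegChar_eq_one_of_mem_inertia`.

No named facts; the only definition is the term-abbreviation `zpowDegChar` (a composition of two
existing homomorphisms).

## Mathlib

USED: `Module.End.exists_eigenvalue`, `Module.End.hasEigenvalue_iff`, `Module.End.mem_eigenspace_iff`,
`IsAlgClosed.exists_pow_nat_eq`, `Complex.isAlgClosed`, `zpowersHom`, `QuotientGroup.map`,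
`Subgroup.quotient_finite_of_isOpen`, `Subgroup.finiteIndex_of_finite_quotient`,
`Subgroup.isOpen_mono`, `Finite.of_surjective`.

## References

* P. Deligne, *Les constantes des équations fonctionnelles des fonctions `L`*, Antwerp II,
  LNM 349 (1973), §3.1, §4.10. [Deligne1973]
* J. Tate, *Number theoretic background*, Corvallis 1979, (2.2.1)–(2.2.3). [Corvallis1979]
* D. Rohrlich, *Root numbers*, in: Arithmetic of `L`-functions (PCMI 2009), IAS/Park City Math.
  Ser. 18 (2011), Lecture 4, Prop. 4.1. [RohrlichPCMI2011]
-/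

noncomputable section

namespace Literature.NumberTheory.GaloisRepresentations

namespace WeilGroup

open Literature.RepresentationTheory.Semisimple

variable {F : Type*} [Field F] [ValuativeRel F] [TopologicalSpace F] [IsNonarchimedeanLocalField F]

/-! ### The unramified characters `w ↦ z ^ deg w` -/

variable (F) in
/-- The unramified character `w ↦ z ^ deg w` of `W_F` attached to `z ∈ ℂˣ` (`zpowersHom` after
`WeilGroup.degHom`, with the discharged facts `IsFrobPow.mul_holds`, `IsFrobPow.unique_holds`).
With `z = q ^ (-s)` this is `ω_s = ‖·‖^s` (`WeilGroup.normCpow`), since `‖w‖ = q ^ deg w`.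
[cite: Corvallis1979, (2.2.1)] -/
def zpowDegChar (z : ℂˣ) : WeilGroup F →* ℂˣ :=
  (zpowersHom ℂˣ z).comp (degHom F IsFrobPow.mul_holds IsFrobPow.unique_holds)

/-- `zpowDegChar z w = z ^ deg w`. [folklore] -/
@[simp] theorem zpowDegChar_apply (z : ℂˣ) (w : WeilGroup F) : zpowDegChar F z w = z ^ deg w := by
  simp [zpowDegChar]

/-- `zpowDegChar z` is unramified: trivial on `I_F` (`deg = 0` there). [cite: Corvallis1979, (2.2.1)] -/
theorem zpowDegChar_eq_one_of_mem_inertia (z : ℂˣ) {u : WeilGroup F} (hu : u ∈ inertia F) :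
    zpowDegChar F z u = 1 := by
  rw [zpowDegChar_apply, (deg_eq_zero_iff_mem_inertia IsFrobPow.mul_holds IsFrobPow.unique_holds).mpr hu,
    zpow_zero]

/-! ### Schur's lemma for an irreducible family of operators -/

/-- **Schur's lemma** (commuting operator form): over `ℂ`, an endomorphism `T` of a non-zero
finite-dimensional space commuting with every `ρ w` of a family with no invariant subspace other
than `⊥`, `⊤` is a scalar — an eigenspace of `T` (`Module.End.exists_eigenvalue`) is a non-zero
invariant subspace. Ref: Serre, *Linear Representations of Finite Groups*, §2.2 Prop. 4. [folklore] -/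
theorem apply_eq_smul_of_forall_comp_eq {V : Type*} [AddCommGroup V] [Module ℂ V]
    [FiniteDimensional ℂ V] [Nontrivial V] {ι : Type*} (ρ : ι → V →ₗ[ℂ] V)
    (hirr : ∀ p : Submodule ℂ V, (∀ i, p ≤ p.comap (ρ i)) → p = ⊥ ∨ p = ⊤)
    (T : V →ₗ[ℂ] V) (hT : ∀ i, T ∘ₗ ρ i = ρ i ∘ₗ T) :
    ∃ c : ℂ, T = c • LinearMap.id := by
  obtain ⟨c, hc⟩ := Module.End.exists_eigenvalue T
  refine ⟨c, ?_⟩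
  set p : Submodule ℂ V := Module.End.eigenspace T c with hp
  have hpinv : ∀ i, p ≤ p.comap (ρ i) := by
    intro i x hx
    rw [Submodule.mem_comap, hp, Module.End.mem_eigenspace_iff]
    rw [hp, Module.End.mem_eigenspace_iff] at hx
    have h := congr($(hT i) x)
    simp only [LinearMap.coe_comp, Function.comp_apply] at h
    rw [h, hx, map_smul]
  rcases hirr p hpinv with h | h
  · exact absurd h (Module.End.hasEigenvalue_iff.mp hc)
  · refine LinearMap.ext fun x => ?_
    have hx : x ∈ p := h ▸ Submodule.mem_top
    rw [hp, Module.End.mem_eigenspace_iff] at hx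
    simpa using hx

/-! ### The theorem -/

/-- In a group, `x ^ k = 1` (`k ≥ 1`) implies `x ^ n = x ^ (n % k)` for `n : ℤ`, with
`0 ≤ n % k < k`. [folklore] -/
theorem zpow_eq_zpow_toNat_emod {G : Type*} [Group G] {x : G} {k : ℕ} (hk : 0 < k)
    (hx : x ^ k = 1) (n : ℤ) :
    x ^ n = x ^ ((n % (k : ℤ)).toNat) ∧ (n % (k : ℤ)).toNat < k := by
  have hk0 : (k : ℤ) ≠ 0 := by exact_mod_cast hk.ne'
  have hnn : 0 ≤ n % (k : ℤ) := Int.emod_nonneg _ hk0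
  have hlt : n % (k : ℤ) < k := Int.emod_lt_of_pos _ (by exact_mod_cast hk)
  refine ⟨?_, by omega⟩
  have e : x ^ n = x ^ (n % (k : ℤ)) := by
    conv_lhs => rw [← Int.emod_add_mul_ediv n k]
    rw [zpow_add, zpow_mul, zpow_natCast, hx, one_zpow, mul_one]
  rw [e, ← zpow_natCast, Int.toNat_of_nonneg hnn]

/-- **An irreducible continuous representation of `W_F` is of Galois type up to an unramified
twist** (Deligne 1973, §4.10 / Prop. 3.1.2; Tate 1979, (2.2.1)–(2.2.3); Rohrlich, Lecture 4
Prop. 4.1), kernel form: for `ρ` finite-dimensional, non-zero, trivial on an open subgroup of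
`I_F` and without proper non-zero invariant subspace, there is an unramified character
`χ = zpowDegChar z` (`χ = 1` on `I_F`) such that the kernel of the twist `ρ ⊗ χ` is an open
subgroup of finite index of `W_F` (so `ρ ⊗ χ` factors through the finite group `W_F / ker`).
[cite: Deligne1973, §4.10] -/
theorem exists_twist_ker_isOpen_finiteIndex {V : Type*} [AddCommGroup V] [Module ℂ V]
    [FiniteDimensional ℂ V] [Nontrivial V] (ρ : Representation ℂ (WeilGroup F) V)
    (hρ : IsContinuousRep ρ)
    (hirr : ∀ p : Submodule ℂ V, (∀ w, p ≤ p.comap (ρ w)) → p = ⊥ ∨ p = ⊤) :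
    ∃ z : ℂˣ, IsOpen ((Representation.twist ρ (zpowDegChar F z)).ker : Set (WeilGroup F)) ∧
      (Representation.twist ρ (zpowDegChar F z)).ker.FiniteIndex := by
  classical
  haveI : IsTopologicalGroup (WeilGroup F) := isTopologicalGroup_holds F
  haveI : CompactSpace (inertia F) := isCompact_iff_compactSpace.mp (isCompact_inertia_holds F)
  obtain ⟨U, hUI, hUo, hU⟩ := hρ
  -- a geometric Frobenius and a central power `ρ(Φ ^ k)`
  obtain ⟨Φ, hΦ⟩ := deg_surjective IsFrobPow.mul_holds IsFrobPow.unique_holds (exists_isFrobPow_holds F) (-1 : ℤ)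
  obtain ⟨k, hk, hcomm⟩ := exists_pow_commute_of_isOpen_ker (M := V →ₗ[ℂ] V) ρ U hUo hU Φ
  set T : V →ₗ[ℂ] V := ρ (Φ ^ k) with hT
  have hTall : ∀ w, T * ρ w = ρ w * T := by
    refine intertwines_of_inertia_of_frob (M := V →ₗ[ℂ] V) ρ ρ T hΦ ?_ fun u hu => (hcomm u hu).eq
    rw [hT, ← map_mul, ← map_mul, ← pow_succ, ← pow_succ']
  -- Schur: `T = c`, `c ≠ 0`
  obtain ⟨c, hc⟩ := apply_eq_smul_of_forall_comp_eq (fun w => ρ w) hirr T fun w => hTall w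
  have hc0 : c ≠ 0 := by
    intro h0
    rw [h0, zero_smul] at hc
    have h1 : T * ρ (Φ ^ k)⁻¹ = 1 := by rw [hT, ← map_mul, mul_inv_cancel, map_one]
    rw [hc, zero_mul] at h1
    exact zero_ne_one h1
  -- `z ^ k = c`
  obtain ⟨z₀, hz₀⟩ := IsAlgClosed.exists_pow_nat_eq c hk
  have hz₀0 : z₀ ≠ 0 := by
    rintro rfl
    rw [zero_pow hk.ne'] at hz₀
    exact hc0 hz₀.symm
  set z : ℂˣ := Units.mk0 z₀ hz₀0 with hz
  set χ := zpowDegChar F z with hχ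
  set K := (Representation.twist ρ χ).ker with hK
  -- `U ≤ K` and `Φ ^ k ∈ K`
  have hUK : U ≤ K := by
    intro u hu
    rw [hK, MonoidHom.mem_ker]
    ext v
    rw [Representation.twist_apply_apply, hU u hu, hχ, zpowDegChar_eq_one_of_mem_inertia z (hUI hu)]
    simp
  have hΦk : Φ ^ k ∈ K := by
    rw [hK, MonoidHom.mem_ker]
    ext v
    rw [Representation.twist_apply_apply, hχ, zpowDegChar_apply, deg_pow, hΦ]
    change ((z ^ ((k : ℤ) * -1) : ℂˣ) : ℂ) • T v = v
    rw [hc, LinearMap.smul_apply, LinearMap.id_apply, smul_smul, mul_neg_one, zpow_neg, zpow_natCast,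
      Units.val_inv_eq_inv_val, Units.val_pow_eq_pow_val, hz, Units.val_mk0, hz₀, inv_mul_cancel₀ hc0,
      one_smul]
  refine ⟨z, Subgroup.isOpen_mono hUK hUo, ?_⟩
  -- finite index: `W_F / K` is covered by `Φ ^ j · (I_F / (K ∩ I_F))`, `j < k`
  haveI hKn : K.Normal := by rw [hK]; exact MonoidHom.normal_ker _
  set K' : Subgroup (inertia F) := K.subgroupOf (inertia F) with hK'
  haveI : K'.Normal := by rw [hK']; infer_instance
  haveI hfin : Finite ((inertia F) ⧸ K') :=
    Subgroup.quotient_finite_of_isOpen _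
      (Subgroup.subgroupOf_isOpen (inertia F) K (Subgroup.isOpen_mono hUK hUo))
  let ι : (inertia F) ⧸ K' →* WeilGroup F ⧸ K :=
    QuotientGroup.map K' K (inertia F).subtype (by rw [hK']; exact le_rfl)
  have hι : ∀ u : inertia F, ι (QuotientGroup.mk u) = QuotientGroup.mk (u : WeilGroup F) := fun u => rfl
  let g : Fin k × ((inertia F) ⧸ K') → WeilGroup F ⧸ K :=
    fun p => (QuotientGroup.mk Φ : WeilGroup F ⧸ K) ^ (p.1 : ℕ) * ι p.2
  have hg : Function.Surjective g := by
    intro q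
    induction q using QuotientGroup.induction_on with
    | H w =>
      have hu : Φ ^ deg w * w ∈ inertia F := zpow_deg_mul_mem_inertia hΦ w
      have hw : w = Φ ^ (-deg w) * (Φ ^ deg w * w) := by
        rw [← mul_assoc, ← zpow_add, neg_add_cancel, zpow_zero, one_mul]
      have hΦK : (QuotientGroup.mk Φ : WeilGroup F ⧸ K) ^ k = 1 := by
        rw [← QuotientGroup.mk_pow, QuotientGroup.eq_one_iff]
        exact hΦk
      obtain ⟨hpow, hlt⟩ := zpow_eq_zpow_toNat_emod hk hΦK (-deg w)
      refine ⟨(⟨_, hlt⟩, QuotientGroup.mk ⟨_, hu⟩), ?_⟩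
      change (QuotientGroup.mk Φ : WeilGroup F ⧸ K) ^ ((-deg w) % (k : ℤ)).toNat * ι (QuotientGroup.mk ⟨_, hu⟩) = _
      rw [hι, ← hpow, ← QuotientGroup.mk_zpow, ← QuotientGroup.mk_mul, ← hw]
  haveI : Finite (WeilGroup F ⧸ K) := Finite.of_surjective g hg
  exact Subgroup.finiteIndex_of_finite_quotient

/-- The same, unfolded for consumers: an unramified `χ : W_F →* ℂˣ` (`χ = 1` on `I_F`) with
`ker (ρ ⊗ χ)` open of finite index, and `ρ = (ρ ⊗ χ) ⊗ χ⁻¹`. [cite: Deligne1973, §4.10] -/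
theorem exists_unramified_twist_ker_isOpen_finiteIndex {V : Type*} [AddCommGroup V] [Module ℂ V]
    [FiniteDimensional ℂ V] [Nontrivial V] (ρ : Representation ℂ (WeilGroup F) V)
    (hρ : IsContinuousRep ρ)
    (hirr : ∀ p : Submodule ℂ V, (∀ w, p ≤ p.comap (ρ w)) → p = ⊥ ∨ p = ⊤) :
    ∃ χ : WeilGroup F →* ℂˣ, (∀ u ∈ inertia F, χ u = 1) ∧
      IsOpen ((Representation.twist ρ χ).ker : Set (WeilGroup F)) ∧
      (Representation.twist ρ χ).ker.FiniteIndex ∧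
      Representation.twist (Representation.twist ρ χ) χ⁻¹ = ρ := by
  obtain ⟨z, ho, hi⟩ := exists_twist_ker_isOpen_finiteIndex ρ hρ hirr
  exact ⟨zpowDegChar F z, fun u hu => zpowDegChar_eq_one_of_mem_inertia z hu, ho, hi,
    Representation.twist_twist_inv ρ _⟩

end WeilGroup

end Literature.NumberTheory.GaloisRepresentations
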